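import Literature.MathematicalPhysics.QuantumFieldTheory.Balaban1983to89.B9Eq3120StepDelta1Pi

/-!
# `Balaban1983to89.B9Eq3130MatrixLetters` — T. Bałaban, *Propagators for lattice gauge theories in a background field*, Commun. Math. Phys.
**99** (1985) 389–434 [Balaban1985BackgroundPropagators], (3.25) p. 394, (3.49) p. 399, (3.120) p. 419, (3.130) p. 421, (3.138)/Theorem 3.12
p. 423: «It is easy to find estimates for the operator Δ′_π, using Theorem 3.1 and the inequality (3.49)» KERNEL-CHECKED AT p10's MATRIX LEVEL — the
block majorants of the words `P = I − R = G′Q′*(Q′G′²Q′*)⁻¹Q′G′` ((3.25); print's (3.49)₁ «using again Lemma 2.1»), `RG′`, `G′RD*`, `RG′D*` and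
`T = 1 − DG′RD*` (the `λ`-letters of the `Δ′_π` step of (3.130)/(3.138), r06 FILES 78/81/82) DERIVED from block majorants of the four PRINTED letters
`G′(U)` (Theorem 3.1 (3.42)₁), `(Q′G′²Q′*)⁻¹(U)` (Theorem 3.2 (3.48)), `Q′(U)`, `Q′*(U)` ((3.19), block-local) and of the derivative letters `D`, `D*`
((3.3)/(3.8), nearest-neighbour), by [4] (2.52)–(2.55) + Lemma 2.1; whence THEOREM 3.12's clause «Theorem 3.11 holds for G₁» END TO END (FILE 82's
`thm312_posDef_G1_step1`) with its four composite `λ`-letters DISCHARGED: the clause now rests on letters for the PRINTED objects only — Theorem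
3.1 (`G′`), Theorem 3.2 (`(Q′G′²Q′*)⁻¹`), Theorem 3.3 (`G₀`, `G₀D`), (3.117)/(3.36) (`K·D`, `D*·K`), Theorem 3.11 (`Δ_a > 0`), block-locality of
`Q′`, `D` — and [5]'s concrete `Δ⁽²⁾`; FILE 83 of the Sect. B–D programme of cell `lit-balaban`, seat r06 (B9 fold owner); rows **B9.Eq3.49**,
**B9.Eq3.130**, **B9.Eq3.138**, **B9.Thm3.12** (member cells; heads are the lead's word)

statement-level skeleton of published theorems with citation tags; proofs where landed; nothing here is a claim about the Yang–Mills mass gap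

CITATION HEADER (lean-in-tree rule).  B9 = [Balaban1985BackgroundPropagators] (held `paper:balaban1985-cmp99-background-propagators`, journal
page = PDF page + 388; renders `…-p011-x2.png`, `…-p031-x2.png`, `…-p033-x2.png` of `b2b-balaban-ref1/pages/1985-cmp99-background-propagators/`;
p. 419 [PDF 31] READ AS AN IMAGE by this seat 2026-08-25).  (3.25) p. 394 [PDF 6]: «Rf = (I − G′Q′\*(Q′G′²Q′\*)⁻¹Q′G′)f, where G′ = G′(U) =
(Δ′_a)⁻¹»; Theorem 3.1 (3.42) p. 397 [PDF 9]: «|(G′(U)λ)(x)|, |(∇_UG′(U)λ)(x)|, |(G′(U)∇\*_Uλ)(x)|, |(Δ_UG′(U)λ)(x)| ≦ B₀[(Lʲη)², Lʲη, Lʲη,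
1]e^{−δ₀d(y,y′)}|λ| for x ∈ Δ(y), y ∈ Λ_j, supp λ ⊂ Δ(y′)»; Theorem 3.2 (3.48) p. 398 [PDF 10]: «Under the assumptions of Theorem 3.1, and with the
same constants, the following inequality holds |(Q′(U)G′²(U)Q′\*(U))⁻¹(y, y′)| ≦ B₀(Lʲη)⁻⁴(L^{j′}η)^{−d}e^{−δ₀d(y,y′)}»; (3.49) p. 399 [PDF 11]:
«These theorems imply all the properties of the operator R, or DRD\*, we will need in the future. For the operator P = I − R we obtain, using again
Lemma 2.1, [|P(x,x′)|, |(DP)_μ(x,x′)|, |(PD\*)_ν(x,x′)|, |(DPD\*)_{μν}(x,x′)|] ≦ O(1)[1, (Lʲη)⁻¹, (Lʲη)⁻¹, (Lʲη)⁻²](L^{j′}η)^{−d}e^{−(1/2)δ₀d(y,y′)}»;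
p. 421 [PDF 33]: «From (3.120) we get G = G₀(I − Δ′_πG₀)⁻¹ = Σ_{n=0}^∞ G₀(Δ′_πG₀)ⁿ. (3.130) It is easy to find estimates for the operator Δ′_π,
using Theorem 3.1 and the inequality (3.49), we have to be careful only with the third term in the definition (3.120) of Δ′_π.»; Theorem 3.12
p. 423 [PDF 35] («Theorems 3.3, 3.10, 3.11 hold for the propagators G, G₁»).  [4] = [Balaban1984PropagatorsII] (2.51)–(2.55) p. 232 (block
majorants; «this property is preserved under the composition of operators possessing it … A summation preserves it also»), Lemma 2.1 (2.61)
p. 234.  [5] = [Balaban1985Averaging] (149) p. 40.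

WHAT IS PROVED (kernel; theorems only — 0 `def`, 0 named fact, 0 sorry).  Currency: r16's block norms `B11SectG.BlockNorm`/`HasMaj` (abstract
norms `bP` on site functions, `bM` on coarse-site functions, `bX` on bond functions; the scale weights `(Lʲη)^p` of (3.42)/(3.48)/(3.49) ride
inside the norms, `B9SectDSup` §1), ONE common constant `Γ ≥ 2` dominating the six letter constants, the cutting costs `κ_P`, `κ_M` and the row-sum
constant `c` of Lemma 2.1 (print's «O(1)»), letters at the rate `δ`, words at the rate `δ − σ` (`σ` = the rate spent in Lemma 2.1).
* §1 bookkeeping: `letter_comp` (a letter `Γe^{−δd}` after a word `Ce^{−(δ−σ)d}`, `C ≤ Γᵏ` ⟹ `Γ^{k+3}e^{−(δ−σ)d}`, [4] (2.52)–(2.55)),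
  `letter_weaken`, `hasMaj_id_ofBlocks` (the identity on the sharp-block sup sizes has `1·e^{−δd}`, `d(y,y) = 0`), `gamma_pow_add_le`.
* §2 THE WORDS from the letters `G′ : bP → bP`, `Q′ : bP → bM`, `Q′* : bM → bP`, `(Q′G′²Q′*)⁻¹ : bM → bM`, `D : bP → bX`, `D* : bX → bP` (each
  `Γe^{−δd}`): **`hasMaj_P349`** (`P = G′Q′*(Q′G′²Q′*)⁻¹Q′G′ : bP → bP`, `Γ¹³e^{−(δ−σ)d}` — (3.49)₁ in block-majorant form at matrix level),
  **`hasMaj_RGp`** (`RG′ = G′ − PG′`, `Γ¹⁷`), **`hasMaj_GpRDt`** (`G′RD* = G′D* − G′PD*`, `Γ²⁰`), **`hasMaj_RGpDt`** (`RG′D* = G′D* − PG′D*`, `Γ²⁰`),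
  **`hasMaj_tOp`** (`T = 1 − D(G′RD*) : bX → bX` for `bX` = the sharp-block sup sizes, `Γ²⁴`).
* §3 THE MATRIX INSTANCES (p10's `B9H163.R Δ Q a = 1 − G′Qᵀ(M′)⁻¹QG′`, `G′ = B9H163.G' Δ Q a`, `M′ = QG′G′Qᵀ`, `T = B9SectDFP.tOp Δ Q a D`):
  `P_apply`, `RGp_apply`, `GpRDt_apply`, `RGpDt_apply`, `tOp_apply` (the words ARE the matrices, pointwise) and the four letters of FILE 82 / FILE 81
  as theorems: **`hasMaj_RGp_matrix`**, **`hasMaj_GpRDt_matrix`**, **`hasMaj_RGpDt_matrix`**, **`hasMaj_tOp_matrix`** (+ `hasMaj_P_matrix`, (3.49)₁).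
* §4 **`thm312_posDef_G1_letters`** — THEOREM 3.12's CLAUSE «THEOREM 3.11 HOLDS FOR G₁» END TO END at p10's matrix level, FILE 82's
  `thm312_posDef_G1_step1` with `hT`, `hRG`, `hW`, `hRGp` DISCHARGED by §3: hypotheses = `Δ_a = K + DRD* + aQ_bᵀQ_b > 0` (Theorem 3.11), the
  letters `G′`, `(M′)⁻¹` (Theorems 3.1/3.2 for `U`), `Q`, `Qᵀ`, `D`, `Dᵀ` (block-local), `G₀ = Δ_a⁻¹`, `G₀D` (Theorem 3.3), `K·D`, `Dᵀ·K` ((3.117),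
  `c_J·Mα₀`), [5]'s concrete `Δ⁽²⁾`, `7σ ≤ δ`, `3σ ≤ δ_G`, and the smallness `Mα₀·D ≤ ½` with `D` an explicit polynomial in `Γ`, `c_J`, `c_J′`,
  `B_G`, `B′_G`, `κ_P`, `c`, `θ₀e^{(δ−2σ)R}` ⟹ `G1inv` invertible, `G₁ > 0`, `G1inv > 0`, the series (3.138) → `G₁` in the sup operator norm.

HONEST SCOPE / NOT CLAIMED.  (i) Theorems 3.1/3.2/3.3, (3.117)+(3.36) and Theorem 3.11 are INPUTS (rows B9.Thm3.1/3.2/3.3/3.11, B9.Eq3.117/3.35):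
block majorants of printed exponential shape for p10's ABSTRACT matrices `G′ = (Δ + aQᵀQ)⁻¹`, `(M′)⁻¹`, `Q`, `D`, `G₀`, `K·D`; the file certifies the
bookkeeping «using Theorem 3.1 and the inequality (3.49)» / «using again Lemma 2.1» between them and the `Δ′_π` step, nothing more.  (ii) As in
FILES 78/80/81/82 the bond norm is the sharp-block SUP size `ofBlocks blk` of the real bond coordinates and `bP`, `bM` are abstract (scale weights
inside); print's state norms carry `|D*A|`-terms and Hölder sizes ((3.131), (3.43)) — not modelled (cell GAPS C-pv21g2-1: uniformly in the scales
the honest currency is the sup ⊕ Hölder state of pub-balaban r1's `B9SectDSup`); one finite lattice at a time; located, zero weight.  (iii) ONE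
constant `Γ ≥ 2` replaces print's `B₀`, `O(1)`, `|Q′| ≦ 1`, the cutting costs and `c₁` of Lemma 2.1 (every letter is weakened to `Γ`); the word
constants are the monomials `Γ¹³ … Γ²⁴` — explicit, crude, unoptimised; rates: one `σ` is lost per word (letter ∘ word compositions only), FILE 82 is
fed at `δ₁ := δ − σ`, FILE 81 at `δ_T := δ − 2σ`.  (iv) `d(y,y) = 0` (`hd0`, [4] (2.46)) enters only through the identity summand of `T`.  (v) The
derivative entries (3.49)₂₋₄ and the kernel `(L^{j′}η)^{−d}` form of (3.49) are FILE 62 `B9Ineq349KernelU` (other currency), not repeated.  NOT summit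
progress.

v1.1 (r06 g29, APPEND-ONLY over v1 p395833 ✓f2458e7df22c; every v1 declaration byte-identical): §5 `piOp_zero` and **`thm312_posDef_G_letters`** —
THEOREM 3.12's clause «Theorem 3.11 holds for G» (the Sect. D `G` of (3.122)/(3.130), no `Δ⁽²⁾`) from letters for the PRINTED objects only, for ANY finite
bond index type `X` (no [5] data): Theorem 3.11 (`Δ_a > 0`), Theorems 3.1/3.2 (`G′`, `(M′)⁻¹`), block-local `Q`, `D`, Theorem 3.3 (`G₀`, `G₀D`), (3.117) (`K·D`,
`Dᵀ·K` of size `m = Mα₀`), `3σ ≤ δ`, smallness explicit ⟹ `Ginv` invertible, (3.130) both members, `G > 0`, `G⁻¹ > 0`.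

RELATED IN THE TREE, NOT DUPLICATED (searched 2026-08-25: `lean search --decl` for `hasMaj_P349`, `hasMaj_tOp`, `MatrixLetters`, `letter_comp` = ∅;
(3.49) files = pv16's abstract `B9Ineq349`, r06 `B9Ineq349Hom`/`B9Ineq368PPrime.ineq349_op` (block majorants of `P(U)` in the `B6RandomWalk(Hom)`
currency on the Sect. A/B carriers), FILE 62 `B9Ineq349KernelU` (printed kernel form), r05's flat/multi-level torus instances — none at p10's matrix
level / `B11SectG` currency): p10 `B9H163` (`R`, `G'`, `M'` — USED), `B9SectDFP` (`tOp` — USED), r16 `B11SectG` (USED: `hasMaj_comp_exp`,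
`HasMaj.sub/.mono/.congr/.of_rate_le`, `hasMaj_of_hasMajorant`), r06 FILE 82 `B9Eq3120StepDelta1Pi` (USED: `thm312_posDef_G1_step1`), FILE 81
`B9Thm312PositivityAssembled`.  Unit `lit-balaban-r06`, HOME `run/shared/lean/pub/lit-balaban/`.
-/

noncomputable section

open scoped BigOperators Matrix

namespace Literature.MathematicalPhysics.QuantumFieldTheory.Balaban1983to89.B9Eq3130MatrixLetters

open Literature.MathematicalPhysics.QuantumFieldTheory.Balaban1983to89
open B11SectG B6RandomWalk B9SectDSup

/-! ## §1 Bookkeeping: a letter after a word, the identity, powers of `Γ` -/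

section Bookkeeping

variable {g : B6.Geometry} {F₁ F₂ F₃ : Type} [AddCommGroup F₁] [Module ℝ F₁] [AddCommGroup F₂] [Module ℝ F₂]
  [AddCommGroup F₃] [Module ℝ F₃]

/-- `κ·Γ·C·c ≤ Γ^{k+3}` for `κ, c ≤ Γ`, `C ≤ Γᵏ`, `Γ ≥ 1`. [folklore] -/
private theorem step_le {κ Γ C c : ℝ} {k : ℕ} (hκ : κ ≤ Γ) (hC0 : 0 ≤ C) (hC : C ≤ Γ ^ k) (hc0 : 0 ≤ c)
    (hc : c ≤ Γ) (hΓ : 1 ≤ Γ) : κ * Γ * C * c ≤ Γ ^ (k + 3) := by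
  have hΓ0 : 0 ≤ Γ := le_trans zero_le_one hΓ
  calc κ * Γ * C * c ≤ Γ * Γ * Γ ^ k * Γ := by gcongr
    _ = Γ ^ (k + 3) := by ring

/-- `Γᵃ + Γᵇ ≤ Γ^{b+1}` for `a ≤ b`, `Γ ≥ 2`. [folklore] -/
private theorem gamma_pow_add_le {Γ : ℝ} {a b : ℕ} (hΓ : 2 ≤ Γ) (hab : a ≤ b) : Γ ^ a + Γ ^ b ≤ Γ ^ (b + 1) := by
  have hΓ1 : 1 ≤ Γ := le_trans one_le_two hΓ
  have h1 : Γ ^ a ≤ Γ ^ b := pow_le_pow_right₀ hΓ1 hab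
  have h2 : 0 ≤ Γ ^ b := pow_nonneg (le_trans zero_le_one hΓ1) b
  calc Γ ^ a + Γ ^ b ≤ 2 * Γ ^ b := by linarith
    _ ≤ Γ * Γ ^ b := mul_le_mul_of_nonneg_right hΓ h2
    _ = Γ ^ (b + 1) := by ring

/-- **a letter after a word** ([4] (2.52)–(2.55) «this property is preserved under the composition of operators possessing it» + Lemma 2.1 at
the rate `σ`): the letter `L : b₂ → b₃` with `Γe^{−δd}` after the word `W : b₁ → b₂` with `Ce^{−(δ−σ)d}`, `C ≤ Γᵏ`, `κ₂, c ≤ Γ`, `Γ ≥ 1` ⟹ `L ∘ W`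
has `Γ^{k+3}e^{−(δ−σ)d}` (the rate is NOT degraded further: the fresh letter carries the margin `σ`).
[cite: Balaban1984PropagatorsII, (2.52)–(2.55) p.232, (2.61) p.234] -/
theorem letter_comp {b₁ : BlockNorm g F₁} {b₂ : BlockNorm g F₂} {b₃ : BlockNorm g F₃} {Lt : F₂ →ₗ[ℝ] F₃} {Wd : F₁ →ₗ[ℝ] F₂}
    {Γ C δ σ c : ℝ} {k : ℕ}
    (htri : Triangle254 g) (hd : ∀ a b : g.Site, 0 ≤ g.dist a b) (hrow : RowSum g σ c) (hc0 : 0 ≤ c) (hσδ : σ ≤ δ)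
    (hΓ : 1 ≤ Γ) (hκ : b₂.κ ≤ Γ) (hc : c ≤ Γ) (hC0 : 0 ≤ C) (hC : C ≤ Γ ^ k)
    (hL : HasMaj b₂ b₃ Lt (fun a b => Γ * Real.exp (-(δ * g.dist a b))))
    (hW : HasMaj b₁ b₂ Wd (fun a b => C * Real.exp (-((δ - σ) * g.dist a b)))) :
    HasMaj b₁ b₃ (Lt ∘ₗ Wd) (fun a b => Γ ^ (k + 3) * Real.exp (-((δ - σ) * g.dist a b))) := by
  have hΓ0 : 0 ≤ Γ := le_trans zero_le_one hΓ
  have h := hasMaj_comp_exp (ρ := δ - σ) htri hd hrow hΓ0 hC0 (by linarith) le_rfl (by linarith) hL hW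
  exact h.mono fun a b => mul_le_mul_of_nonneg_right (step_le hκ hC0 hC hc0 hc hΓ) (Real.exp_nonneg _)

/-- a letter `Γe^{−δd}` read as a one-letter word `Γ¹e^{−(δ−σ)d}`. [cite: Balaban1984PropagatorsII, (2.51) p.232] -/
theorem letter_weaken {b₁ : BlockNorm g F₁} {b₂ : BlockNorm g F₂} {Lt : F₁ →ₗ[ℝ] F₂} {Γ δ σ : ℝ}
    (hd : ∀ a b : g.Site, 0 ≤ g.dist a b) (hσ : 0 ≤ σ) (hΓ : 1 ≤ Γ)
    (hL : HasMaj b₁ b₂ Lt (fun a b => Γ * Real.exp (-(δ * g.dist a b)))) :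
    HasMaj b₁ b₂ Lt (fun a b => Γ ^ 1 * Real.exp (-((δ - σ) * g.dist a b))) := by
  rw [pow_one]
  exact hL.of_rate_le hd (le_trans zero_le_one hΓ) (by linarith)

/-- **the identity on the sharp-block sup sizes** has the majorant `1·e^{−δd}` ([4] (2.51) with `d(y,y) = 0`, (2.46)): a function vanishing off
the block of `y′` has size `0` near every other block. [cite: Balaban1984PropagatorsII, (2.51) p.232, (2.46) p.231] -/
theorem hasMaj_id_ofBlocks {X : Type} [Fintype X] (blk : X → g.Site) (hd0 : ∀ y : g.Site, g.dist y y = 0) (δ : ℝ) :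
    HasMaj (BlockNorm.ofBlocks g blk) (BlockNorm.ofBlocks g blk) (LinearMap.id : (X → ℝ) →ₗ[ℝ] (X → ℝ))
      (fun a b => 1 * Real.exp (-(δ * g.dist a b))) := by
  refine hasMaj_of_hasMajorant blk (fun a b => mul_nonneg zero_le_one (Real.exp_nonneg _)) ?_
  intro y' μ B hμ x
  by_cases hx : blk x = y'
  · have h1 : Real.exp (-(δ * g.dist (blk x) y')) = 1 := by rw [hx, hd0 y']; simp
    show |LinearMap.id μ x| ≤ 1 * Real.exp (-(δ * g.dist (blk x) y')) * B
    rw [LinearMap.id_apply, h1, one_mul, one_mul]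
    exact hμ.bound x hx
  · show |LinearMap.id μ x| ≤ 1 * Real.exp (-(δ * g.dist (blk x) y')) * B
    rw [LinearMap.id_apply, hμ.off x hx, abs_zero]
    exact mul_nonneg (mul_nonneg zero_le_one (Real.exp_nonneg _)) hμ.nonneg

end Bookkeeping

/-! ## §2 The words `P`, `RG′`, `G′RD*`, `RG′D*`, `T` from the letters `G′`, `Q′`, `Q′*`, `(Q′G′²Q′*)⁻¹`, `D`, `D*` -/

section Words

variable {g : B6.Geometry} {FX P Mm : Type} [AddCommGroup FX] [Module ℝ FX] [AddCommGroup P] [Module ℝ P]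
  [AddCommGroup Mm] [Module ℝ Mm]
variable {bX : BlockNorm g FX} {bP : BlockNorm g P} {bM : BlockNorm g Mm}
variable {Gp : P →ₗ[ℝ] P} {Qm : P →ₗ[ℝ] Mm} {Qt : Mm →ₗ[ℝ] P} {Mi : Mm →ₗ[ℝ] Mm} {Dm : P →ₗ[ℝ] FX} {Dt : FX →ₗ[ℝ] P}
variable {Γ δ σ c : ℝ}

/-- **(3.49)₁ at matrix level: `P = G′Q′*(Q′G′²Q′*)⁻¹Q′G′`** «using again Lemma 2.1»: from `G′` (Theorem 3.1 (3.42)₁), `Q′`, `Q′*` ((3.19)) and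
`(Q′G′²Q′*)⁻¹` (Theorem 3.2 (3.48)), each `Γe^{−δd}`, the word `G′ ∘ (Q′* ∘ ((Q′G′²Q′*)⁻¹ ∘ (Q′ ∘ G′)))` has `Γ¹³e^{−(δ−σ)d}`.
[cite: Balaban1985BackgroundPropagators, (3.49) p.399, (3.25) p.394, Thm 3.1 (3.42) p.397, Thm 3.2 (3.48) p.398] [cite: Balaban1984PropagatorsII, (2.52)–(2.55) p.232, (2.61) p.234] -/
theorem hasMaj_P349 (htri : Triangle254 g) (hd : ∀ a b : g.Site, 0 ≤ g.dist a b) (hrow : RowSum g σ c) (hc0 : 0 ≤ c) (hσ : 0 ≤ σ)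
    (hσδ : σ ≤ δ) (hΓ : 1 ≤ Γ) (hκP : bP.κ ≤ Γ) (hκM : bM.κ ≤ Γ) (hc : c ≤ Γ)
    (hGp : HasMaj bP bP Gp (fun a b => Γ * Real.exp (-(δ * g.dist a b))))
    (hQ : HasMaj bP bM Qm (fun a b => Γ * Real.exp (-(δ * g.dist a b))))
    (hQt : HasMaj bM bP Qt (fun a b => Γ * Real.exp (-(δ * g.dist a b))))
    (hMi : HasMaj bM bM Mi (fun a b => Γ * Real.exp (-(δ * g.dist a b)))) :
    HasMaj bP bP (Gp ∘ₗ (Qt ∘ₗ (Mi ∘ₗ (Qm ∘ₗ Gp)))) (fun a b => Γ ^ 13 * Real.exp (-((δ - σ) * g.dist a b))) := by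
  have hΓ0 : 0 ≤ Γ := le_trans zero_le_one hΓ
  have w0 := letter_weaken hd hσ hΓ hGp
  have w1 := letter_comp htri hd hrow hc0 hσδ hΓ hκP hc (pow_nonneg hΓ0 1) le_rfl hQ w0
  have w2 := letter_comp htri hd hrow hc0 hσδ hΓ hκM hc (pow_nonneg hΓ0 _) le_rfl hMi w1
  have w3 := letter_comp htri hd hrow hc0 hσδ hΓ hκM hc (pow_nonneg hΓ0 _) le_rfl hQt w2
  exact letter_comp htri hd hrow hc0 hσδ hΓ hκP hc (pow_nonneg hΓ0 _) le_rfl hGp w3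

/-- **`RG′ = G′ − PG′ = G′ − G′Q′*(Q′G′²Q′*)⁻¹Q′G′G′`** (R of (3.25)) has `Γ¹⁷e^{−(δ−σ)d}` («a summation preserves it also»).
[cite: Balaban1985BackgroundPropagators, (3.25) p.394, (3.49) p.399, p.421 (after (3.130))] [cite: Balaban1984PropagatorsII, (2.52)–(2.55) p.232, (2.61) p.234] -/
theorem hasMaj_RGp (htri : Triangle254 g) (hd : ∀ a b : g.Site, 0 ≤ g.dist a b) (hrow : RowSum g σ c) (hc0 : 0 ≤ c) (hσ : 0 ≤ σ)
    (hσδ : σ ≤ δ) (hΓ : 2 ≤ Γ) (hκP : bP.κ ≤ Γ) (hκM : bM.κ ≤ Γ) (hc : c ≤ Γ)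
    (hGp : HasMaj bP bP Gp (fun a b => Γ * Real.exp (-(δ * g.dist a b))))
    (hQ : HasMaj bP bM Qm (fun a b => Γ * Real.exp (-(δ * g.dist a b))))
    (hQt : HasMaj bM bP Qt (fun a b => Γ * Real.exp (-(δ * g.dist a b))))
    (hMi : HasMaj bM bM Mi (fun a b => Γ * Real.exp (-(δ * g.dist a b)))) :
    HasMaj bP bP (Gp - Gp ∘ₗ (Qt ∘ₗ (Mi ∘ₗ (Qm ∘ₗ (Gp ∘ₗ Gp))))) (fun a b => Γ ^ 17 * Real.exp (-((δ - σ) * g.dist a b))) := by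
  have hΓ1 : 1 ≤ Γ := le_trans one_le_two hΓ
  have hΓ0 : 0 ≤ Γ := le_trans zero_le_one hΓ1
  have v0 := letter_weaken hd hσ hΓ1 hGp
  have v1 := letter_comp htri hd hrow hc0 hσδ hΓ1 hκP hc (pow_nonneg hΓ0 1) le_rfl hGp v0
  have v2 := letter_comp htri hd hrow hc0 hσδ hΓ1 hκP hc (pow_nonneg hΓ0 _) le_rfl hQ v1
  have v3 := letter_comp htri hd hrow hc0 hσδ hΓ1 hκM hc (pow_nonneg hΓ0 _) le_rfl hMi v2
  have v4 := letter_comp htri hd hrow hc0 hσδ hΓ1 hκM hc (pow_nonneg hΓ0 _) le_rfl hQt v3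
  have v5 := letter_comp htri hd hrow hc0 hσδ hΓ1 hκP hc (pow_nonneg hΓ0 _) le_rfl hGp v4
  refine (v0.sub v5).mono fun a b => ?_
  rw [← add_mul]
  exact mul_le_mul_of_nonneg_right (gamma_pow_add_le hΓ (by norm_num)) (Real.exp_nonneg _)

/-- **`G′RD* = G′D* − G′PD* = G′D* − G′G′Q′*(Q′G′²Q′*)⁻¹Q′G′D*`** (the `λ`-map of (3.120), `λ = G′RD*A`) has `Γ²⁰e^{−(δ−σ)d}`, with `D* : bX → bP`
(`Γe^{−δd}`, nearest-neighbour). [cite: Balaban1985BackgroundPropagators, (3.120) p.419, (3.25) p.394, (3.49) p.399, p.421 (after (3.130))]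
[cite: Balaban1984PropagatorsII, (2.52)–(2.55) p.232, (2.61) p.234] -/
theorem hasMaj_GpRDt (htri : Triangle254 g) (hd : ∀ a b : g.Site, 0 ≤ g.dist a b) (hrow : RowSum g σ c) (hc0 : 0 ≤ c) (hσ : 0 ≤ σ)
    (hσδ : σ ≤ δ) (hΓ : 2 ≤ Γ) (hκP : bP.κ ≤ Γ) (hκM : bM.κ ≤ Γ) (hc : c ≤ Γ)
    (hGp : HasMaj bP bP Gp (fun a b => Γ * Real.exp (-(δ * g.dist a b))))
    (hQ : HasMaj bP bM Qm (fun a b => Γ * Real.exp (-(δ * g.dist a b))))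
    (hQt : HasMaj bM bP Qt (fun a b => Γ * Real.exp (-(δ * g.dist a b))))
    (hMi : HasMaj bM bM Mi (fun a b => Γ * Real.exp (-(δ * g.dist a b))))
    (hDt : HasMaj bX bP Dt (fun a b => Γ * Real.exp (-(δ * g.dist a b)))) :
    HasMaj bX bP (Gp ∘ₗ Dt - Gp ∘ₗ (Gp ∘ₗ (Qt ∘ₗ (Mi ∘ₗ (Qm ∘ₗ (Gp ∘ₗ Dt))))))
      (fun a b => Γ ^ 20 * Real.exp (-((δ - σ) * g.dist a b))) := by
  have hΓ1 : 1 ≤ Γ := le_trans one_le_two hΓ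
  have hΓ0 : 0 ≤ Γ := le_trans zero_le_one hΓ1
  have t0 := letter_weaken hd hσ hΓ1 hDt
  have t1 := letter_comp htri hd hrow hc0 hσδ hΓ1 hκP hc (pow_nonneg hΓ0 1) le_rfl hGp t0
  have t2 := letter_comp htri hd hrow hc0 hσδ hΓ1 hκP hc (pow_nonneg hΓ0 _) le_rfl hQ t1
  have t3 := letter_comp htri hd hrow hc0 hσδ hΓ1 hκM hc (pow_nonneg hΓ0 _) le_rfl hMi t2
  have t4 := letter_comp htri hd hrow hc0 hσδ hΓ1 hκM hc (pow_nonneg hΓ0 _) le_rfl hQt t3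
  have t5 := letter_comp htri hd hrow hc0 hσδ hΓ1 hκP hc (pow_nonneg hΓ0 _) le_rfl hGp t4
  have t6 := letter_comp htri hd hrow hc0 hσδ hΓ1 hκP hc (pow_nonneg hΓ0 _) le_rfl hGp t5
  refine (t1.sub t6).mono fun a b => ?_
  rw [← add_mul]
  exact mul_le_mul_of_nonneg_right (gamma_pow_add_le hΓ (by norm_num)) (Real.exp_nonneg _)

/-- **`RG′D* = G′D* − PG′D* = G′D* − G′Q′*(Q′G′²Q′*)⁻¹Q′G′G′D*`** (FILE 81's letter `hRG`) has `Γ²⁰e^{−(δ−σ)d}`.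
[cite: Balaban1985BackgroundPropagators, (3.120) p.419, (3.25) p.394, (3.49) p.399, p.423 (after (3.138))]
[cite: Balaban1984PropagatorsII, (2.52)–(2.55) p.232, (2.61) p.234] -/
theorem hasMaj_RGpDt (htri : Triangle254 g) (hd : ∀ a b : g.Site, 0 ≤ g.dist a b) (hrow : RowSum g σ c) (hc0 : 0 ≤ c) (hσ : 0 ≤ σ)
    (hσδ : σ ≤ δ) (hΓ : 2 ≤ Γ) (hκP : bP.κ ≤ Γ) (hκM : bM.κ ≤ Γ) (hc : c ≤ Γ)
    (hGp : HasMaj bP bP Gp (fun a b => Γ * Real.exp (-(δ * g.dist a b))))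
    (hQ : HasMaj bP bM Qm (fun a b => Γ * Real.exp (-(δ * g.dist a b))))
    (hQt : HasMaj bM bP Qt (fun a b => Γ * Real.exp (-(δ * g.dist a b))))
    (hMi : HasMaj bM bM Mi (fun a b => Γ * Real.exp (-(δ * g.dist a b))))
    (hDt : HasMaj bX bP Dt (fun a b => Γ * Real.exp (-(δ * g.dist a b)))) :
    HasMaj bX bP (Gp ∘ₗ Dt - Gp ∘ₗ (Qt ∘ₗ (Mi ∘ₗ (Qm ∘ₗ (Gp ∘ₗ (Gp ∘ₗ Dt))))))
      (fun a b => Γ ^ 20 * Real.exp (-((δ - σ) * g.dist a b))) := by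
  have hΓ1 : 1 ≤ Γ := le_trans one_le_two hΓ
  have hΓ0 : 0 ≤ Γ := le_trans zero_le_one hΓ1
  have t0 := letter_weaken hd hσ hΓ1 hDt
  have t1 := letter_comp htri hd hrow hc0 hσδ hΓ1 hκP hc (pow_nonneg hΓ0 1) le_rfl hGp t0
  have u2 := letter_comp htri hd hrow hc0 hσδ hΓ1 hκP hc (pow_nonneg hΓ0 _) le_rfl hGp t1
  have u3 := letter_comp htri hd hrow hc0 hσδ hΓ1 hκP hc (pow_nonneg hΓ0 _) le_rfl hQ u2
  have u4 := letter_comp htri hd hrow hc0 hσδ hΓ1 hκM hc (pow_nonneg hΓ0 _) le_rfl hMi u3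
  have u5 := letter_comp htri hd hrow hc0 hσδ hΓ1 hκM hc (pow_nonneg hΓ0 _) le_rfl hQt u4
  have u6 := letter_comp htri hd hrow hc0 hσδ hΓ1 hκP hc (pow_nonneg hΓ0 _) le_rfl hGp u5
  refine (t1.sub u6).mono fun a b => ?_
  rw [← add_mul]
  exact mul_le_mul_of_nonneg_right (gamma_pow_add_le hΓ (by norm_num)) (Real.exp_nonneg _)

/-- **`T = 1 − D(G′RD*)`** ((3.119) `A ↦ A − DG′RD*A`) on the sharp-block sup sizes of the bond functions has `Γ²⁴e^{−(δ−σ)d}`: the identity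
(`hasMaj_id_ofBlocks`), `D : bP → bX` (`Γe^{−δd}`, nearest-neighbour) after the `λ`-word of `hasMaj_GpRDt` (`Γ²⁰`).
[cite: Balaban1985BackgroundPropagators, (3.119) p.419, p.421 (after (3.130))] [cite: Balaban1984PropagatorsII, (2.52)–(2.55) p.232, (2.61) p.234] -/
theorem hasMaj_tOp {X : Type} [Fintype X] {blk : X → g.Site} {Dm' : P →ₗ[ℝ] (X → ℝ)} {Dt' : (X → ℝ) →ₗ[ℝ] P}
    (htri : Triangle254 g) (hd : ∀ a b : g.Site, 0 ≤ g.dist a b) (hd0 : ∀ y : g.Site, g.dist y y = 0) (hrow : RowSum g σ c)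
    (hc0 : 0 ≤ c) (hσ : 0 ≤ σ) (hσδ : σ ≤ δ) (hΓ : 2 ≤ Γ) (hκP : bP.κ ≤ Γ) (hκM : bM.κ ≤ Γ) (hc : c ≤ Γ)
    (hGp : HasMaj bP bP Gp (fun a b => Γ * Real.exp (-(δ * g.dist a b))))
    (hQ : HasMaj bP bM Qm (fun a b => Γ * Real.exp (-(δ * g.dist a b))))
    (hQt : HasMaj bM bP Qt (fun a b => Γ * Real.exp (-(δ * g.dist a b))))
    (hMi : HasMaj bM bM Mi (fun a b => Γ * Real.exp (-(δ * g.dist a b))))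
    (hDm : HasMaj bP (BlockNorm.ofBlocks g blk) Dm' (fun a b => Γ * Real.exp (-(δ * g.dist a b))))
    (hDt : HasMaj (BlockNorm.ofBlocks g blk) bP Dt' (fun a b => Γ * Real.exp (-(δ * g.dist a b)))) :
    HasMaj (BlockNorm.ofBlocks g blk) (BlockNorm.ofBlocks g blk)
      (LinearMap.id - Dm' ∘ₗ (Gp ∘ₗ Dt' - Gp ∘ₗ (Gp ∘ₗ (Qt ∘ₗ (Mi ∘ₗ (Qm ∘ₗ (Gp ∘ₗ Dt')))))))
      (fun a b => Γ ^ 24 * Real.exp (-((δ - σ) * g.dist a b))) := by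
  have hΓ1 : 1 ≤ Γ := le_trans one_le_two hΓ
  have hΓ0 : 0 ≤ Γ := le_trans zero_le_one hΓ1
  have hW := hasMaj_GpRDt htri hd hrow hc0 hσ hσδ hΓ hκP hκM hc hGp hQ hQt hMi hDt
  have hDW := letter_comp htri hd hrow hc0 hσδ hΓ1 hκP hc (pow_nonneg hΓ0 _) le_rfl hDm hW
  have hid := (hasMaj_id_ofBlocks blk hd0 δ).of_rate_le hd zero_le_one (show δ - σ ≤ δ by linarith)
  refine (hid.sub hDW).mono fun a b => ?_
  rw [← add_mul]
  refine mul_le_mul_of_nonneg_right ?_ (Real.exp_nonneg _)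
  calc (1 : ℝ) + Γ ^ (20 + 3) = Γ ^ 0 + Γ ^ 23 := by norm_num
    _ ≤ Γ ^ 24 := gamma_pow_add_le hΓ (by norm_num)

end Words

/-! ## §3 The matrix instances: `P = 1 − R`, `RG′`, `G′RD*`, `RG′D*`, `T` for p10's `B9H163.R`, `B9SectDFP.tOp` -/

section MatrixWords

variable {g : B6.Geometry} {X n m : Type} [Fintype X] [Fintype n] [Fintype m] [DecidableEq X] [DecidableEq n] [DecidableEq m]

/-- `P = 1 − R = G′Qᵀ(M′)⁻¹QG′` (p10's `B9H163.R Δ Q a = 1 − G′Qᵀ(M′)⁻¹QG′`; (3.25)) applied to a site function IS the word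
`G′ ∘ (Qᵀ ∘ ((M′)⁻¹ ∘ (Q ∘ G′)))`. [cite: Balaban1985BackgroundPropagators, (3.25) p.394, (3.49) p.399] -/
theorem P_apply (Δ : Matrix n n ℝ) (Q : Matrix m n ℝ) (a : ℝ) (μ : n → ℝ) :
    (Matrix.mulVecLin (B9H163.G' Δ Q a) ∘ₗ (Matrix.mulVecLin Qᵀ ∘ₗ (Matrix.mulVecLin (B9H163.M' Δ Q a)⁻¹ ∘ₗ
      (Matrix.mulVecLin Q ∘ₗ Matrix.mulVecLin (B9H163.G' Δ Q a))))) μ =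
      Matrix.mulVecLin (1 - B9H163.R Δ Q a) μ := by
  rw [B9H163.R, sub_sub_cancel]
  simp only [LinearMap.comp_apply, Matrix.mulVecLin_apply, Matrix.mulVec_mulVec, Matrix.mul_assoc]

/-- `RG′ = G′ − G′Qᵀ(M′)⁻¹QG′G′` pointwise. [cite: Balaban1985BackgroundPropagators, (3.25) p.394, p.421 (after (3.130))] -/
theorem RGp_apply (Δ : Matrix n n ℝ) (Q : Matrix m n ℝ) (a : ℝ) (μ : n → ℝ) :
    (Matrix.mulVecLin (B9H163.G' Δ Q a) - Matrix.mulVecLin (B9H163.G' Δ Q a) ∘ₗ (Matrix.mulVecLin Qᵀ ∘ₗ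
      (Matrix.mulVecLin (B9H163.M' Δ Q a)⁻¹ ∘ₗ (Matrix.mulVecLin Q ∘ₗ (Matrix.mulVecLin (B9H163.G' Δ Q a) ∘ₗ
        Matrix.mulVecLin (B9H163.G' Δ Q a)))))) μ =
      Matrix.mulVecLin (B9H163.R Δ Q a * B9H163.G' Δ Q a) μ := by
  rw [B9H163.R]
  simp only [LinearMap.sub_apply, LinearMap.comp_apply, Matrix.mulVecLin_apply, Matrix.mulVec_mulVec, Matrix.sub_mul,
    Matrix.one_mul, Matrix.sub_mulVec, Matrix.mul_assoc]

omit [DecidableEq X] in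
/-- `G′RDᵀ = G′Dᵀ − G′G′Qᵀ(M′)⁻¹QG′Dᵀ` pointwise. [cite: Balaban1985BackgroundPropagators, (3.120) p.419, (3.25) p.394] -/
theorem GpRDt_apply (Δ : Matrix n n ℝ) (Q : Matrix m n ℝ) (a : ℝ) (D : Matrix X n ℝ) (μ : X → ℝ) :
    (Matrix.mulVecLin (B9H163.G' Δ Q a) ∘ₗ Matrix.mulVecLin Dᵀ -
      Matrix.mulVecLin (B9H163.G' Δ Q a) ∘ₗ (Matrix.mulVecLin (B9H163.G' Δ Q a) ∘ₗ (Matrix.mulVecLin Qᵀ ∘ₗ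
        (Matrix.mulVecLin (B9H163.M' Δ Q a)⁻¹ ∘ₗ (Matrix.mulVecLin Q ∘ₗ (Matrix.mulVecLin (B9H163.G' Δ Q a) ∘ₗ
          Matrix.mulVecLin Dᵀ)))))) μ =
      Matrix.mulVecLin (B9H163.G' Δ Q a * B9H163.R Δ Q a * Dᵀ) μ := by
  rw [B9H163.R]
  simp only [LinearMap.sub_apply, LinearMap.comp_apply, Matrix.mulVecLin_apply, Matrix.mulVec_mulVec, Matrix.sub_mul,
    Matrix.mul_sub, Matrix.mul_one, Matrix.sub_mulVec, Matrix.mul_assoc]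

omit [DecidableEq X] in
/-- `RG′Dᵀ = G′Dᵀ − G′Qᵀ(M′)⁻¹QG′G′Dᵀ` pointwise. [cite: Balaban1985BackgroundPropagators, (3.120) p.419, (3.25) p.394] -/
theorem RGpDt_apply (Δ : Matrix n n ℝ) (Q : Matrix m n ℝ) (a : ℝ) (D : Matrix X n ℝ) (μ : X → ℝ) :
    (Matrix.mulVecLin (B9H163.G' Δ Q a) ∘ₗ Matrix.mulVecLin Dᵀ -
      Matrix.mulVecLin (B9H163.G' Δ Q a) ∘ₗ (Matrix.mulVecLin Qᵀ ∘ₗ (Matrix.mulVecLin (B9H163.M' Δ Q a)⁻¹ ∘ₗ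
        (Matrix.mulVecLin Q ∘ₗ (Matrix.mulVecLin (B9H163.G' Δ Q a) ∘ₗ (Matrix.mulVecLin (B9H163.G' Δ Q a) ∘ₗ
          Matrix.mulVecLin Dᵀ)))))) μ =
      Matrix.mulVecLin (B9H163.R Δ Q a * B9H163.G' Δ Q a * Dᵀ) μ := by
  rw [B9H163.R]
  simp only [LinearMap.sub_apply, LinearMap.comp_apply, Matrix.mulVecLin_apply, Matrix.mulVec_mulVec, Matrix.sub_mul,
    Matrix.one_mul, Matrix.sub_mulVec, Matrix.mul_assoc]

/-- `T = 1 − D(G′RDᵀ)` pointwise (p10's `B9SectDFP.tOp Δ Q a D = 1 − DG′RDᵀ`). [cite: Balaban1985BackgroundPropagators, (3.119) p.419] -/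
theorem tOp_apply (Δ : Matrix n n ℝ) (Q : Matrix m n ℝ) (a : ℝ) (D : Matrix X n ℝ) (μ : X → ℝ) :
    ((LinearMap.id : (X → ℝ) →ₗ[ℝ] (X → ℝ)) - Matrix.mulVecLin D ∘ₗ (Matrix.mulVecLin (B9H163.G' Δ Q a) ∘ₗ Matrix.mulVecLin Dᵀ -
      Matrix.mulVecLin (B9H163.G' Δ Q a) ∘ₗ (Matrix.mulVecLin (B9H163.G' Δ Q a) ∘ₗ (Matrix.mulVecLin Qᵀ ∘ₗ
        (Matrix.mulVecLin (B9H163.M' Δ Q a)⁻¹ ∘ₗ (Matrix.mulVecLin Q ∘ₗ (Matrix.mulVecLin (B9H163.G' Δ Q a) ∘ₗ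
          Matrix.mulVecLin Dᵀ))))))) μ =
      Matrix.mulVecLin (B9SectDFP.tOp Δ Q a D) μ := by
  have h := GpRDt_apply Δ Q a D μ
  rw [LinearMap.sub_apply, LinearMap.id_apply, LinearMap.comp_apply, h, B9SectDFP.tOp]
  simp only [Matrix.mulVecLin_apply, Matrix.mulVec_mulVec, Matrix.sub_mulVec, Matrix.one_mulVec, Matrix.mul_assoc]

variable {bP : BlockNorm g (n → ℝ)} {bM : BlockNorm g (m → ℝ)} {Γ δ σ c : ℝ}

/-- (3.49)₁ AT MATRIX LEVEL: `P = 1 − R` for p10's `R` has `Γ¹³e^{−(δ−σ)d}` from the letters `G′`, `Q`, `Qᵀ`, `(M′)⁻¹`.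
[cite: Balaban1985BackgroundPropagators, (3.49) p.399, (3.25) p.394, Thm 3.1 (3.42) p.397, Thm 3.2 (3.48) p.398] [cite: Balaban1984PropagatorsII, (2.52)–(2.55) p.232, (2.61) p.234] -/
theorem hasMaj_P_matrix (Δ : Matrix n n ℝ) (Q : Matrix m n ℝ) (a : ℝ)
    (htri : Triangle254 g) (hd : ∀ a b : g.Site, 0 ≤ g.dist a b) (hrow : RowSum g σ c) (hc0 : 0 ≤ c) (hσ : 0 ≤ σ)
    (hσδ : σ ≤ δ) (hΓ : 1 ≤ Γ) (hκP : bP.κ ≤ Γ) (hκM : bM.κ ≤ Γ) (hc : c ≤ Γ)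
    (hGp : HasMaj bP bP (Matrix.mulVecLin (B9H163.G' Δ Q a)) (fun a b => Γ * Real.exp (-(δ * g.dist a b))))
    (hQ : HasMaj bP bM (Matrix.mulVecLin Q) (fun a b => Γ * Real.exp (-(δ * g.dist a b))))
    (hQt : HasMaj bM bP (Matrix.mulVecLin Qᵀ) (fun a b => Γ * Real.exp (-(δ * g.dist a b))))
    (hMi : HasMaj bM bM (Matrix.mulVecLin (B9H163.M' Δ Q a)⁻¹) (fun a b => Γ * Real.exp (-(δ * g.dist a b)))) :
    HasMaj bP bP (Matrix.mulVecLin (1 - B9H163.R Δ Q a)) (fun a b => Γ ^ 13 * Real.exp (-((δ - σ) * g.dist a b))) :=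
  (hasMaj_P349 htri hd hrow hc0 hσ hσδ hΓ hκP hκM hc hGp hQ hQt hMi).congr (P_apply Δ Q a)

/-- `RG′` AT MATRIX LEVEL (FILE 82's letter `hRGp`): `Γ¹⁷e^{−(δ−σ)d}` from the letters `G′`, `Q`, `Qᵀ`, `(M′)⁻¹`.
[cite: Balaban1985BackgroundPropagators, (3.25) p.394, (3.49) p.399, p.421 (after (3.130))] [cite: Balaban1984PropagatorsII, (2.52)–(2.55) p.232, (2.61) p.234] -/
theorem hasMaj_RGp_matrix (Δ : Matrix n n ℝ) (Q : Matrix m n ℝ) (a : ℝ)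
    (htri : Triangle254 g) (hd : ∀ a b : g.Site, 0 ≤ g.dist a b) (hrow : RowSum g σ c) (hc0 : 0 ≤ c) (hσ : 0 ≤ σ)
    (hσδ : σ ≤ δ) (hΓ : 2 ≤ Γ) (hκP : bP.κ ≤ Γ) (hκM : bM.κ ≤ Γ) (hc : c ≤ Γ)
    (hGp : HasMaj bP bP (Matrix.mulVecLin (B9H163.G' Δ Q a)) (fun a b => Γ * Real.exp (-(δ * g.dist a b))))
    (hQ : HasMaj bP bM (Matrix.mulVecLin Q) (fun a b => Γ * Real.exp (-(δ * g.dist a b))))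
    (hQt : HasMaj bM bP (Matrix.mulVecLin Qᵀ) (fun a b => Γ * Real.exp (-(δ * g.dist a b))))
    (hMi : HasMaj bM bM (Matrix.mulVecLin (B9H163.M' Δ Q a)⁻¹) (fun a b => Γ * Real.exp (-(δ * g.dist a b)))) :
    HasMaj bP bP (Matrix.mulVecLin (B9H163.R Δ Q a * B9H163.G' Δ Q a))
      (fun a b => Γ ^ 17 * Real.exp (-((δ - σ) * g.dist a b))) :=
  (hasMaj_RGp htri hd hrow hc0 hσ hσδ hΓ hκP hκM hc hGp hQ hQt hMi).congr (RGp_apply Δ Q a)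

omit [DecidableEq X] in
/-- `G′RDᵀ` AT MATRIX LEVEL (FILE 82's letter `hW`, the `λ`-map of (3.120)): `Γ²⁰e^{−(δ−σ)d}` from the letters `G′`, `Q`, `Qᵀ`, `(M′)⁻¹`, `Dᵀ`.
[cite: Balaban1985BackgroundPropagators, (3.120) p.419, (3.25) p.394, (3.49) p.399] [cite: Balaban1984PropagatorsII, (2.52)–(2.55) p.232, (2.61) p.234] -/
theorem hasMaj_GpRDt_matrix {bX : BlockNorm g (X → ℝ)} (Δ : Matrix n n ℝ) (Q : Matrix m n ℝ) (a : ℝ) (D : Matrix X n ℝ)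
    (htri : Triangle254 g) (hd : ∀ a b : g.Site, 0 ≤ g.dist a b) (hrow : RowSum g σ c) (hc0 : 0 ≤ c) (hσ : 0 ≤ σ)
    (hσδ : σ ≤ δ) (hΓ : 2 ≤ Γ) (hκP : bP.κ ≤ Γ) (hκM : bM.κ ≤ Γ) (hc : c ≤ Γ)
    (hGp : HasMaj bP bP (Matrix.mulVecLin (B9H163.G' Δ Q a)) (fun a b => Γ * Real.exp (-(δ * g.dist a b))))
    (hQ : HasMaj bP bM (Matrix.mulVecLin Q) (fun a b => Γ * Real.exp (-(δ * g.dist a b))))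
    (hQt : HasMaj bM bP (Matrix.mulVecLin Qᵀ) (fun a b => Γ * Real.exp (-(δ * g.dist a b))))
    (hMi : HasMaj bM bM (Matrix.mulVecLin (B9H163.M' Δ Q a)⁻¹) (fun a b => Γ * Real.exp (-(δ * g.dist a b))))
    (hDt : HasMaj bX bP (Matrix.mulVecLin Dᵀ) (fun a b => Γ * Real.exp (-(δ * g.dist a b)))) :
    HasMaj bX bP (Matrix.mulVecLin (B9H163.G' Δ Q a * B9H163.R Δ Q a * Dᵀ))
      (fun a b => Γ ^ 20 * Real.exp (-((δ - σ) * g.dist a b))) :=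
  (hasMaj_GpRDt htri hd hrow hc0 hσ hσδ hΓ hκP hκM hc hGp hQ hQt hMi hDt).congr (GpRDt_apply Δ Q a D)

omit [DecidableEq X] in
/-- `RG′Dᵀ` AT MATRIX LEVEL (FILE 81's letter `hRG`): `Γ²⁰e^{−(δ−σ)d}` from the letters `G′`, `Q`, `Qᵀ`, `(M′)⁻¹`, `Dᵀ`.
[cite: Balaban1985BackgroundPropagators, (3.120) p.419, (3.25) p.394, (3.49) p.399, p.423 (after (3.138))] [cite: Balaban1984PropagatorsII, (2.52)–(2.55) p.232, (2.61) p.234] -/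
theorem hasMaj_RGpDt_matrix {bX : BlockNorm g (X → ℝ)} (Δ : Matrix n n ℝ) (Q : Matrix m n ℝ) (a : ℝ) (D : Matrix X n ℝ)
    (htri : Triangle254 g) (hd : ∀ a b : g.Site, 0 ≤ g.dist a b) (hrow : RowSum g σ c) (hc0 : 0 ≤ c) (hσ : 0 ≤ σ)
    (hσδ : σ ≤ δ) (hΓ : 2 ≤ Γ) (hκP : bP.κ ≤ Γ) (hκM : bM.κ ≤ Γ) (hc : c ≤ Γ)
    (hGp : HasMaj bP bP (Matrix.mulVecLin (B9H163.G' Δ Q a)) (fun a b => Γ * Real.exp (-(δ * g.dist a b))))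
    (hQ : HasMaj bP bM (Matrix.mulVecLin Q) (fun a b => Γ * Real.exp (-(δ * g.dist a b))))
    (hQt : HasMaj bM bP (Matrix.mulVecLin Qᵀ) (fun a b => Γ * Real.exp (-(δ * g.dist a b))))
    (hMi : HasMaj bM bM (Matrix.mulVecLin (B9H163.M' Δ Q a)⁻¹) (fun a b => Γ * Real.exp (-(δ * g.dist a b))))
    (hDt : HasMaj bX bP (Matrix.mulVecLin Dᵀ) (fun a b => Γ * Real.exp (-(δ * g.dist a b)))) :
    HasMaj bX bP (Matrix.mulVecLin (B9H163.R Δ Q a * B9H163.G' Δ Q a * Dᵀ))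
      (fun a b => Γ ^ 20 * Real.exp (-((δ - σ) * g.dist a b))) :=
  (hasMaj_RGpDt htri hd hrow hc0 hσ hσδ hΓ hκP hκM hc hGp hQ hQt hMi hDt).congr (RGpDt_apply Δ Q a D)

/-- `T = tOp Δ Q a D` AT MATRIX LEVEL (FILE 81's letter `hT`) on the sharp-block sup sizes of the bond coordinates: `Γ²⁴e^{−(δ−σ)d}` from the
letters `G′`, `Q`, `Qᵀ`, `(M′)⁻¹`, `D`, `Dᵀ` and `d(y,y) = 0`. [cite: Balaban1985BackgroundPropagators, (3.119) p.419, p.421 (after (3.130))]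
[cite: Balaban1984PropagatorsII, (2.52)–(2.55) p.232, (2.61) p.234] -/
theorem hasMaj_tOp_matrix {blk : X → g.Site} (Δ : Matrix n n ℝ) (Q : Matrix m n ℝ) (a : ℝ) (D : Matrix X n ℝ)
    (htri : Triangle254 g) (hd : ∀ a b : g.Site, 0 ≤ g.dist a b) (hd0 : ∀ y : g.Site, g.dist y y = 0) (hrow : RowSum g σ c)
    (hc0 : 0 ≤ c) (hσ : 0 ≤ σ) (hσδ : σ ≤ δ) (hΓ : 2 ≤ Γ) (hκP : bP.κ ≤ Γ) (hκM : bM.κ ≤ Γ) (hc : c ≤ Γ)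
    (hGp : HasMaj bP bP (Matrix.mulVecLin (B9H163.G' Δ Q a)) (fun a b => Γ * Real.exp (-(δ * g.dist a b))))
    (hQ : HasMaj bP bM (Matrix.mulVecLin Q) (fun a b => Γ * Real.exp (-(δ * g.dist a b))))
    (hQt : HasMaj bM bP (Matrix.mulVecLin Qᵀ) (fun a b => Γ * Real.exp (-(δ * g.dist a b))))
    (hMi : HasMaj bM bM (Matrix.mulVecLin (B9H163.M' Δ Q a)⁻¹) (fun a b => Γ * Real.exp (-(δ * g.dist a b))))
    (hDm : HasMaj bP (BlockNorm.ofBlocks g blk) (Matrix.mulVecLin D) (fun a b => Γ * Real.exp (-(δ * g.dist a b))))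
    (hDt : HasMaj (BlockNorm.ofBlocks g blk) bP (Matrix.mulVecLin Dᵀ) (fun a b => Γ * Real.exp (-(δ * g.dist a b)))) :
    HasMaj (BlockNorm.ofBlocks g blk) (BlockNorm.ofBlocks g blk) (Matrix.mulVecLin (B9SectDFP.tOp Δ Q a D))
      (fun a b => Γ ^ 24 * Real.exp (-((δ - σ) * g.dist a b))) :=
  (hasMaj_tOp htri hd hd0 hrow hc0 hσ hσδ hΓ hκP hκM hc hGp hQ hQt hMi hDm hDt).congr (tOp_apply Δ Q a D)

end MatrixWords

/-! ## §4 Theorem 3.12's clause «Theorem 3.11 holds for G₁» from letters for the printed objects only -/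

section Assembled

open NormedSpace Finset Metric Filter
open B7Prop1Explicit B7Prop1Local B7Prop2Explicit B7Prop3Flat B7Prop4Flat B7Eq92Concrete B7Prop3GeneralLinear
  B7Prop4GeneralLevels B7Prop5GeneralOperators B7Prop5GeneralInduction B7Prop5GeneralLevels B7Ineq149Pairing B7Eq136SecondOrder
  B9Ineq3137From149 B9Eq3134MatrixConcrete

variable {d : ℕ}
variable {𝔸 : Type*} [NormedRing 𝔸] [NormedAlgebra ℂ 𝔸] [CompleteSpace 𝔸] [NormOneClass 𝔸]

variable (L : ℕ) (hL : 2 ≤ L) {G : Subgroup 𝔸ˣ} (hG : AvgClosed d L G) (k : ℕ)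
  (U₀ : B7Prop1Explicit.Site d → Fin d → 𝔸ˣ) (hU₀ : ∀ x κ, U₀ x κ ∈ G) {α₀ : ℝ} (hα : 0 < α₀)
  (hα3 : C0 d * α₀ ≤ 1 / 3) (hα4 : 4 * α₀ ≤ c2' d L) (h52 : pdev U₀ < α₀ * (((L : ℝ) ^ k)⁻¹) ^ 2)
  {b : ℝ} (hb : 0 < b)
  (hsmall : Real.exp (4 * (800 * ((d : ℝ) + 1) ^ 2 * ((d : ℝ) + 4)) * α₀)
    * (1 + 8 * (131072 * ((d : ℝ) + 1) ^ 2) * ((L : ℝ) ^ k * b)) ≤ 2)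
  (hc₃ : 4 * ((L : ℝ) ^ k * b) < c3 d L)
  (h145 : 8 * d * thetaGen d L α₀ * (L : ℝ)⁻¹ ^ 4 ≤ 1)
  (h155 : (2 * (L : ℝ) - 1) * (L : ℝ)⁻¹ ^ 2 + 2 * d * thetaGen d L α₀ * (L : ℝ)⁻¹ ^ 3
    + 1 / 8 * (1 + 2 * d * thetaGen d L α₀ * (L : ℝ)⁻¹ ^ 2 + 2 * d * C3Gen d L * ((L : ℝ) ^ k * b)) * (L : ℝ)⁻¹ ^ 2 ≤ 1)
  (S : Finset (B7Prop1Explicit.Site d × Fin d))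
  (lv : Finset ℕ) (T : ℕ → Finset (B7Prop1Explicit.Site d × Fin d)) (w : ℕ → B7Prop1Explicit.Site d × Fin d → ℝ)
  (K : ℕ → B7Prop1Explicit.Site d × Fin d → 𝔸)

variable {ι : Type} [Fintype ι] [DecidableEq ι] (e : ι → 𝔸) (τ : 𝔸 →L[ℝ] ℝ)
variable {g : B6.Geometry} (blk : S × ι → g.Site)
variable {n m q : Type} [Fintype n] [Fintype m] [Fintype q] [DecidableEq n] [DecidableEq m]

include hL hG hU₀ hα hα3 hα4 h52 hb hsmall hc₃ h145 h155 in
/-- **THEOREM 3.12's CLAUSE «THEOREM 3.11 HOLDS FOR G₁» FROM LETTERS FOR THE PRINTED OBJECTS ONLY** (p10's matrix level): `K` symmetric (the bond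
form `Δ` of ⟨A,ΔA⟩), `Δ` symmetric, `Δ_a = K + DRD* + aQ_bᵀQ_b > 0` (Theorem 3.11; `G₀ := Δ_a⁻¹`); block majorants `Γe^{−δd}` (`Γ ≥ 2` dominating
also `κ_P`, `κ_M` and Lemma 2.1's `c_r`) of `G′ = B9H163.G' Δ Q a` (Theorem 3.1 (3.42)₁), `(M′)⁻¹ = (QG′G′Qᵀ)⁻¹` (Theorem 3.2 (3.48)), `Q`, `Qᵀ`
((3.19), block-local), `D`, `Dᵀ` ((3.3)/(3.8), nearest-neighbour); the Theorem 3.3 letters `B_Ge^{−δ_Gd}`, `B′_Ge^{−δ_Gd}` of `G₀`, `G₀D`; the (3.117)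
letters `c_J·Mα₀·e^{−δd}`, `c_J′·Mα₀·e^{−δd}` of `K·D`, `Dᵀ·K` («the error terms are small because the function J … is small»); `d(y,y) = 0`; rates
`7σ ≤ δ`, `3σ ≤ δ_G`; [5]'s concrete `Δ⁽²⁾` (its current data `K j c` with `w·‖K‖ ≤ c₀Mα₀(Lʲ)^{d−2}`); and the smallness `Mα₀·D ≤ ½`,
`D = max(1,κ_P)(B_G + B′_G)(c₁ + c₂)c_r²`, `c₁ = κ_P c_J Γ²⁰c_r + κ_P Γ¹⁷c_J′ Γ²⁴c_r²`, `c₂ = θ₀e^{(δ−2σ)R}Γ²⁴c_r(1 + Γ²⁰c_r)`,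
`θ₀ = 2dC₃‖τ‖(Σ_i‖e_i‖)M_e c₀·#lv` ⟹ with `𝒞 := ½Δ⁽²⁾`: `G1inv K 𝒞 …` is invertible, `(G1inv …)⁻¹ > 0`, `G1inv … > 0`, and
`Σ_n G₀((Δ′_π + Δ⁽²⁾_π)G₀)ⁿ` converges to `(G1inv …)⁻¹` in the sup operator norm — FILE 82's `thm312_posDef_G1_step1` with its letters `hT`, `hRG`,
`hW`, `hRGp` DISCHARGED by §3 («It is easy to find estimates for the operator Δ′_π, using Theorem 3.1 and the inequality (3.49)»).
[cite: Balaban1985BackgroundPropagators, Thm 3.12 p.423, (3.138) p.423, (3.130) p.421, (3.117)–(3.120) p.419, (3.49) p.399, (3.25) p.394, Thm 3.1 (3.42) p.397, Thm 3.2 (3.48) p.398, Thm 3.11 p.416, (3.128) p.421]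
[cite: Balaban1984PropagatorsII, (2.52)–(2.55) p.232, (2.61) p.234] [cite: Balaban1985Averaging, (149) p.40] -/
theorem thm312_posDef_G1_letters (hd : 2 ≤ d) (hJ : ∀ j ∈ lv, j ≤ k) (hw : ∀ j ∈ lv, ∀ c ∈ T j, 0 ≤ w j c)
    {c₀ M Me : ℝ} (hc₀ : 0 ≤ c₀) (hM : 0 ≤ M) (hMe : 0 ≤ Me) (he : ∀ i, ‖e i‖ ≤ Me)
    (hK : ∀ j ∈ lv, ∀ c ∈ T j, w j c * ‖K j c‖ ≤ c₀ * M * α₀ * ((L : ℝ) ^ j) ^ (d - 2))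
    {R : ℝ} (hR : ∀ j ∈ lv, ∀ c ∈ T j, ∀ y y' : g.Site, BoxMeets L S blk j c y → BoxMeets L S blk j c y' → g.dist y y' ≤ R)
    (Kb : Matrix (S × ι) (S × ι) ℝ) (hKb : Kbᵀ = Kb) (Δ : Matrix n n ℝ) (hΔ : Δ.IsSymm) (Q : Matrix m n ℝ) (a : ℝ) (D : Matrix (S × ι) n ℝ)
    (Qb : Matrix q (S × ι) ℝ) (ab : ℝ) (hΔa : (Kb + D * B9H163.R Δ Q a * Dᵀ + ab • (Qbᵀ * Qb)).PosDef)
    {bP : BlockNorm g (n → ℝ)} {bM : BlockNorm g (m → ℝ)} {Γ cJ cJ' BG BG' δ δG σ cr : ℝ}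
    (htri : B6RandomWalk.Triangle254 g) (hdist : ∀ y y' : g.Site, 0 ≤ g.dist y y') (hd0 : ∀ y : g.Site, g.dist y y = 0)
    (hrow : RowSum g σ cr) (hcr : 0 ≤ cr) (hΓ : 2 ≤ Γ) (hκP : bP.κ ≤ Γ) (hκM : bM.κ ≤ Γ) (hcΓ : cr ≤ Γ)
    (hcJ : 0 ≤ cJ) (hcJ' : 0 ≤ cJ') (hBG : 0 ≤ BG) (hBG' : 0 ≤ BG') (hσ : 0 ≤ σ) (hσδ : 7 * σ ≤ δ) (hσG : 3 * σ ≤ δG)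
    (hGp : HasMaj bP bP (Matrix.mulVecLin (B9H163.G' Δ Q a)) (fun y y' => Γ * Real.exp (-(δ * g.dist y y'))))
    (hQ : HasMaj bP bM (Matrix.mulVecLin Q) (fun y y' => Γ * Real.exp (-(δ * g.dist y y'))))
    (hQt : HasMaj bM bP (Matrix.mulVecLin Qᵀ) (fun y y' => Γ * Real.exp (-(δ * g.dist y y'))))
    (hMi : HasMaj bM bM (Matrix.mulVecLin (B9H163.M' Δ Q a)⁻¹) (fun y y' => Γ * Real.exp (-(δ * g.dist y y'))))
    (hDm : HasMaj bP (BlockNorm.ofBlocks g blk) (Matrix.mulVecLin D) (fun y y' => Γ * Real.exp (-(δ * g.dist y y'))))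
    (hDt : HasMaj (BlockNorm.ofBlocks g blk) bP (Matrix.mulVecLin Dᵀ) (fun y y' => Γ * Real.exp (-(δ * g.dist y y'))))
    (hJ1 : HasMaj bP (BlockNorm.ofBlocks g blk) (Matrix.mulVecLin (Kb * D))
      (fun y y' => cJ * (M * α₀) * Real.exp (-(δ * g.dist y y'))))
    (hJt : HasMaj (BlockNorm.ofBlocks g blk) bP (Matrix.mulVecLin (Dᵀ * Kb))
      (fun y y' => cJ' * (M * α₀) * Real.exp (-(δ * g.dist y y'))))
    (hG0 : HasMaj (BlockNorm.ofBlocks g blk) (BlockNorm.ofBlocks g blk)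
      (Matrix.mulVecLin (Kb + D * B9H163.R Δ Q a * Dᵀ + ab • (Qbᵀ * Qb))⁻¹) (fun y y' => BG * Real.exp (-(δG * g.dist y y'))))
    (hG0D : HasMaj bP (BlockNorm.ofBlocks g blk) (Matrix.mulVecLin ((Kb + D * B9H163.R Δ Q a * Dᵀ + ab • (Qbᵀ * Qb))⁻¹ * D))
      (fun y y' => BG' * Real.exp (-(δG * g.dist y y'))))
    (hsm : M * α₀ * (max 1 bP.κ * (BG + BG') *
        ((bP.κ * cJ * Γ ^ 20 * cr + bP.κ * Γ ^ 17 * cJ' * Γ ^ 24 * cr * cr) +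
          (2 * d * C3Gen d L * ‖τ‖ * (∑ i, ‖e i‖) * Me * c₀ * lv.card) * Real.exp ((δ - σ - σ) * R) * Γ ^ 24 * cr *
            (1 + Γ ^ 20 * cr)) * cr * cr) ≤ 1 / 2) :
    IsUnit (B9Eq3152.G1inv Kb ((1 / 2 : ℝ) • B9Delta2Def134.delta2 (calC L U₀ S lv T w K e τ)) Δ Q a D Qb ab).det ∧
    ((B9Eq3152.G1inv Kb ((1 / 2 : ℝ) • B9Delta2Def134.delta2 (calC L U₀ S lv T w K e τ)) Δ Q a D Qb ab)⁻¹).PosDef ∧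
    (B9Eq3152.G1inv Kb ((1 / 2 : ℝ) • B9Delta2Def134.delta2 (calC L U₀ S lv T w K e τ)) Δ Q a D Qb ab).PosDef ∧
    HasSum (fun n : ℕ => (Kb + D * B9H163.R Δ Q a * Dᵀ + ab • (Qbᵀ * Qb))⁻¹ *
        (((Kb - B9SectDFP.piOp Kb Δ Q a D) + B9Delta2Def134.delta2pi (calC L U₀ S lv T w K e τ) Δ Q a D) *
          (Kb + D * B9H163.R Δ Q a * Dᵀ + ab • (Qbᵀ * Qb))⁻¹) ^ n)
      (B9Eq3152.G1inv Kb ((1 / 2 : ℝ) • B9Delta2Def134.delta2 (calC L U₀ S lv T w K e τ)) Δ Q a D Qb ab)⁻¹ := by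
  have hΓ1 : 1 ≤ Γ := le_trans one_le_two hΓ
  have hΓ0 : 0 ≤ Γ := le_trans zero_le_one hΓ1
  have hσδ' : σ ≤ δ := by linarith
  have hMα : 0 ≤ M * α₀ := mul_nonneg hM hα.le
  -- §3: the four composite letters of FILES 81/82 at the rate `δ − σ`
  have hT := hasMaj_tOp_matrix Δ Q a D htri hdist hd0 hrow hcr hσ hσδ' hΓ hκP hκM hcΓ hGp hQ hQt hMi hDm hDt
  have hRG := hasMaj_RGpDt_matrix Δ Q a D htri hdist hrow hcr hσ hσδ' hΓ hκP hκM hcΓ hGp hQ hQt hMi hDt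
  have hW := hasMaj_GpRDt_matrix Δ Q a D htri hdist hrow hcr hσ hσδ' hΓ hκP hκM hcΓ hGp hQ hQt hMi hDt
  have hRGp := hasMaj_RGp_matrix Δ Q a htri hdist hrow hcr hσ hσδ' hΓ hκP hκM hcΓ hGp hQ hQt hMi
  -- the (3.117) letters weakened to the common rate `δ − σ`
  have hJ1' := hJ1.of_rate_le hdist (mul_nonneg hcJ hMα) (show δ - σ ≤ δ by linarith)
  have hJt' := hJt.of_rate_le hdist (mul_nonneg hcJ' hMα) (show δ - σ ≤ δ by linarith)
  exact B9Eq3120StepDelta1Pi.thm312_posDef_G1_step1 L hL hG k U₀ hU₀ hα hα3 hα4 h52 hb hsmall hc₃ h145 h155 S lv T w K e τ blk hd hJ hw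
    hc₀ hM hMe he hK hR Kb hKb Δ hΔ Q a D Qb ab hΔa htri hdist hrow hcr hcJ hcJ' (pow_nonneg hΓ0 20) (pow_nonneg hΓ0 17)
    (pow_nonneg hΓ0 24) (pow_nonneg hΓ0 20) hBG hBG' hσ (by linarith) hσG hJ1' hJt' hW hRGp hT hRG hG0 hG0D hsm

end Assembled

/-! ## §5 (v1.1) Theorem 3.12's clause «Theorem 3.11 holds for G» ((3.130), the Sect. D `G` without `Δ⁽²⁾`) from letters for the printed objects -/

section AssembledG

variable {g : B6.Geometry} {X n m q : Type} [Fintype X] [Fintype n] [Fintype m] [Fintype q] [DecidableEq X] [DecidableEq n] [DecidableEq m]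

/-- `Δ_π` of the zero form vanishes: `Tᵀ0T = 0`. [cite: Balaban1985BackgroundPropagators, (3.119) p.419] -/
theorem piOp_zero (Δ : Matrix n n ℝ) (Q : Matrix m n ℝ) (a : ℝ) (D : Matrix X n ℝ) :
    B9SectDFP.piOp (0 : Matrix X X ℝ) Δ Q a D = 0 := by
  rw [B9SectDFP.piOp, Matrix.mul_zero, Matrix.zero_mul]

/-- **THEOREM 3.12's CLAUSE «THEOREM 3.11 HOLDS FOR G» ((3.130): `G = G₀(I − Δ′_πG₀)⁻¹ = Σ_n G₀(Δ′_πG₀)ⁿ`, `G⁻¹ = Δ_π + DRD* + Q*aQ` of (3.122))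
FROM LETTERS FOR THE PRINTED OBJECTS ONLY**, p10's matrix level, ANY finite bond index type `X` with sharp blocks `blk : X → 𝔅`: `K` symmetric,
`Δ` symmetric, `Δ_a = K + DRD* + aQ_bᵀQ_b > 0` (Theorem 3.11; `G₀ := Δ_a⁻¹`); block majorants `Γe^{−δd}` (`Γ ≥ 2 ≥ κ_P, κ_M, c_r`) of `G′` (Theorem 3.1),
`(M′)⁻¹ = (QG′G′Qᵀ)⁻¹` (Theorem 3.2), `Q`, `Qᵀ`, `D`, `Dᵀ` (block-local); the Theorem 3.3 letters `B_Ge^{−δ_Gd}`, `B′_Ge^{−δ_Gd}` of `G₀`, `G₀D`; the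
(3.117) letters `c_J·m·e^{−δd}`, `c_J′·m·e^{−δd}` of `K·D`, `Dᵀ·K` (`m` = print's `Mα₀`: «the error terms are small because the function J … is
small»); `d(y,y) = 0`; `3σ ≤ δ`, `2σ ≤ δ_G`; smallness `m·[max(1,κ_P)(B_G + B′_G)(κ_P c_J Γ²⁰c_r + κ_P Γ¹⁷c_J′Γ²⁴c_r²)c_r²] ≤ ½` ⟹ `G⁻¹ = Ginv K …`
is invertible, `G = G₀(I − Δ′_πG₀)⁻¹` ((3.130), first member), `G > 0`, `G⁻¹ > 0`, and `Σ_n G₀(Δ′_πG₀)ⁿ → G` in the sup operator norm ((3.130),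
second member) — FILE 82's `step1_factored`/`hasMaj_T1'`, §3's matrix letters, FILE 78's `hasMaj_G`, FILE 80's `rowSum_le_of_hasMaj_exp` /
`expansion_posDef_left` / `eq3138_hasSum_posDef_left` (at `𝒞 = 0`). [cite: Balaban1985BackgroundPropagators, Thm 3.12 p.423, (3.130) p.421, (3.122) p.420, (3.117)–(3.120) p.419, Thm 3.11 p.416, (3.49) p.399]
[cite: Balaban1984PropagatorsII, (2.52)–(2.55) p.232, (2.61) p.234] -/
theorem thm312_posDef_G_letters (blk : X → g.Site)
    (Kb : Matrix X X ℝ) (hKb : Kbᵀ = Kb) (Δ : Matrix n n ℝ) (hΔ : Δ.IsSymm) (Q : Matrix m n ℝ) (a : ℝ) (D : Matrix X n ℝ)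
    (Qb : Matrix q X ℝ) (ab : ℝ) (hΔa : (Kb + D * B9H163.R Δ Q a * Dᵀ + ab • (Qbᵀ * Qb)).PosDef)
    {bP : BlockNorm g (n → ℝ)} {bM : BlockNorm g (m → ℝ)} {Γ cJ cJ' m₀ BG BG' δ δG σ cr : ℝ}
    (htri : B6RandomWalk.Triangle254 g) (hdist : ∀ y y' : g.Site, 0 ≤ g.dist y y') (hd0 : ∀ y : g.Site, g.dist y y = 0)
    (hrow : RowSum g σ cr) (hcr : 0 ≤ cr) (hΓ : 2 ≤ Γ) (hκP : bP.κ ≤ Γ) (hκM : bM.κ ≤ Γ) (hcΓ : cr ≤ Γ)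
    (hcJ : 0 ≤ cJ) (hcJ' : 0 ≤ cJ') (hm₀ : 0 ≤ m₀) (hBG : 0 ≤ BG) (hBG' : 0 ≤ BG') (hσ : 0 ≤ σ) (hσδ : 3 * σ ≤ δ) (hσG : 2 * σ ≤ δG)
    (hGp : HasMaj bP bP (Matrix.mulVecLin (B9H163.G' Δ Q a)) (fun y y' => Γ * Real.exp (-(δ * g.dist y y'))))
    (hQ : HasMaj bP bM (Matrix.mulVecLin Q) (fun y y' => Γ * Real.exp (-(δ * g.dist y y'))))
    (hQt : HasMaj bM bP (Matrix.mulVecLin Qᵀ) (fun y y' => Γ * Real.exp (-(δ * g.dist y y'))))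
    (hMi : HasMaj bM bM (Matrix.mulVecLin (B9H163.M' Δ Q a)⁻¹) (fun y y' => Γ * Real.exp (-(δ * g.dist y y'))))
    (hDm : HasMaj bP (BlockNorm.ofBlocks g blk) (Matrix.mulVecLin D) (fun y y' => Γ * Real.exp (-(δ * g.dist y y'))))
    (hDt : HasMaj (BlockNorm.ofBlocks g blk) bP (Matrix.mulVecLin Dᵀ) (fun y y' => Γ * Real.exp (-(δ * g.dist y y'))))
    (hJ1 : HasMaj bP (BlockNorm.ofBlocks g blk) (Matrix.mulVecLin (Kb * D))
      (fun y y' => cJ * m₀ * Real.exp (-(δ * g.dist y y'))))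
    (hJt : HasMaj (BlockNorm.ofBlocks g blk) bP (Matrix.mulVecLin (Dᵀ * Kb))
      (fun y y' => cJ' * m₀ * Real.exp (-(δ * g.dist y y'))))
    (hG0 : HasMaj (BlockNorm.ofBlocks g blk) (BlockNorm.ofBlocks g blk)
      (Matrix.mulVecLin (Kb + D * B9H163.R Δ Q a * Dᵀ + ab • (Qbᵀ * Qb))⁻¹) (fun y y' => BG * Real.exp (-(δG * g.dist y y'))))
    (hG0D : HasMaj bP (BlockNorm.ofBlocks g blk) (Matrix.mulVecLin ((Kb + D * B9H163.R Δ Q a * Dᵀ + ab • (Qbᵀ * Qb))⁻¹ * D))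
      (fun y y' => BG' * Real.exp (-(δG * g.dist y y'))))
    (hsm : m₀ * (max 1 bP.κ * (BG + BG') * (bP.κ * cJ * Γ ^ 20 * cr + bP.κ * Γ ^ 17 * cJ' * Γ ^ 24 * cr * cr) * cr * cr) ≤ 1 / 2) :
    IsUnit (B9SectDFP.Ginv Kb Δ Q a D Qb ab).det ∧
    (B9SectDFP.Ginv Kb Δ Q a D Qb ab)⁻¹ =
      (Kb + D * B9H163.R Δ Q a * Dᵀ + ab • (Qbᵀ * Qb))⁻¹ *
        (1 - (Kb - B9SectDFP.piOp Kb Δ Q a D) * (Kb + D * B9H163.R Δ Q a * Dᵀ + ab • (Qbᵀ * Qb))⁻¹)⁻¹ ∧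
    ((B9SectDFP.Ginv Kb Δ Q a D Qb ab)⁻¹).PosDef ∧ (B9SectDFP.Ginv Kb Δ Q a D Qb ab).PosDef ∧
    HasSum (fun n : ℕ => (Kb + D * B9H163.R Δ Q a * Dᵀ + ab • (Qbᵀ * Qb))⁻¹ *
        ((Kb - B9SectDFP.piOp Kb Δ Q a D) * (Kb + D * B9H163.R Δ Q a * Dᵀ + ab • (Qbᵀ * Qb))⁻¹) ^ n)
      (B9SectDFP.Ginv Kb Δ Q a D Qb ab)⁻¹ := by
  set G0inv : Matrix X X ℝ := Kb + D * B9H163.R Δ Q a * Dᵀ + ab • (Qbᵀ * Qb) with hG0inv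
  set Tp : Matrix X X ℝ := Kb - B9SectDFP.piOp Kb Δ Q a D with hTpdef
  have hΓ1 : 1 ≤ Γ := le_trans one_le_two hΓ
  have hΓ0 : 0 ≤ Γ := le_trans zero_le_one hΓ1
  have hσδ' : σ ≤ δ := by linarith
  -- §3: the λ-letters at the rate `δ − σ`, the (3.117) letters weakened to it
  have hT := hasMaj_tOp_matrix Δ Q a D htri hdist hd0 hrow hcr hσ hσδ' hΓ hκP hκM hcΓ hGp hQ hQt hMi hDm hDt
  have hW := hasMaj_GpRDt_matrix Δ Q a D htri hdist hrow hcr hσ hσδ' hΓ hκP hκM hcΓ hGp hQ hQt hMi hDt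
  have hRGp := hasMaj_RGp_matrix Δ Q a htri hdist hrow hcr hσ hσδ' hΓ hκP hκM hcΓ hGp hQ hQt hMi
  have hJ1' := hJ1.of_rate_le hdist (mul_nonneg hcJ hm₀) (show δ - σ ≤ δ by linarith)
  have hJt' := hJt.of_rate_le hdist (mul_nonneg hcJ' hm₀) (show δ - σ ≤ δ by linarith)
  -- FILE 82: the explicit `𝒯₁` and its majorant at the rate `δ − 2σ`
  have hT1 := B9Eq3120StepDelta1Pi.hasMaj_T1' (ρ := δ - 2 * σ) htri hdist hrow hcJ hcJ' hm₀ (pow_nonneg hΓ0 20) (pow_nonneg hΓ0 17)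
    (pow_nonneg hΓ0 24) (by linarith) hσ (by linarith) hJ1' hJt' hW hRGp hT
  have hκX : (BlockNorm.ofBlocks g blk).κ = 1 := rfl
  rw [hκX, mul_one, ← B9Eq3120StepDelta1Pi.T1_matrix_eq Kb Δ Q a D] at hT1
  -- `𝒢 = G₀ ⊕ G₀D` (FILE 78) and the composition at the rate `σ`
  have hGG := B9Eq3138StepDelta2Pi.hasMaj_G hdist hBG hBG' hG0 hG0D
  have hc₁ : 0 ≤ (bP.κ * cJ * Γ ^ 20 * cr + bP.κ * Γ ^ 17 * cJ' * Γ ^ 24 * cr * cr) * m₀ := by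
    have := bP.κ_nonneg
    positivity
  have hcomp := hasMaj_comp_exp htri hdist hrow (add_nonneg hBG hBG') hc₁ hσ (show σ ≤ δ - 2 * σ by linarith)
    (show σ + σ ≤ δG by linarith) hGG hT1
  rw [← B9Eq3120StepDelta1Pi.step1_factored _ Kb Δ Q a D hΔ, Module.End.mul_eq_comp, ← Matrix.mulVecLin_mul] at hcomp
  have hκ : (prodNorm (BlockNorm.ofBlocks g blk) bP).κ = max 1 bP.κ := rfl
  rw [hκ] at hcomp
  -- the LEFT sup letter: row sums of `|G₀Δ′_π|`
  set ρ : ℝ := max 1 bP.κ * (BG + BG') * ((bP.κ * cJ * Γ ^ 20 * cr + bP.κ * Γ ^ 17 * cJ' * Γ ^ 24 * cr * cr) * m₀) * cr * cr with hρdef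
  have hρ0 : 0 ≤ ρ := by
    have := bP.κ_nonneg
    have : 0 ≤ max 1 bP.κ := le_trans zero_le_one (le_max_left _ _)
    positivity
  have hρhalf : ρ ≤ 1 / 2 := by
    have : ρ = m₀ * (max 1 bP.κ * (BG + BG') * (bP.κ * cJ * Γ ^ 20 * cr + bP.κ * Γ ^ 17 * cJ' * Γ ^ 24 * cr * cr) * cr * cr) := by
      rw [hρdef]; ring
    rw [this]; exact hsm
  have hρ1 : ρ < 1 := by linarith
  have hrows : ∀ i, ∑ j, |(G0inv⁻¹ * Tp) i j| ≤ ρ := fun i => by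
    have h := B9Thm312Positivity.rowSum_le_of_hasMaj_exp blk (G0inv⁻¹ * Tp)
      (mul_nonneg (mul_nonneg (mul_nonneg (le_trans zero_le_one (le_max_left _ _)) (add_nonneg hBG hBG')) hc₁) hcr) hrow hcomp i
    rw [hρdef]
    linarith
  -- FILE 80: invertibility, (3.130) first member, positivity — from the left letter
  have hTp : Tpᵀ = Tp := by rw [hTpdef, Matrix.transpose_sub, hKb, B9Thm312Positivity.piOp_transpose Kb hKb]
  have hG0idet : IsUnit G0inv.det := (Matrix.isUnit_iff_isUnit_det _).mp hΔa.isUnit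
  obtain ⟨-, hres, hleft, -, -, hpos⟩ := B9Thm312Positivity.expansion_posDef_left G0inv⁻¹ Tp hΔa.inv hTp hρ1 hrows
  have hM : G0inv⁻¹⁻¹ - Tp = B9SectDFP.Ginv Kb Δ Q a D Qb ab := by
    rw [Matrix.nonsing_inv_nonsing_inv _ hG0idet, hG0inv, hTpdef]
    exact B9Thm312Positivity.G0inv_sub_eq_Ginv Kb Δ Q a D Qb ab
  rw [hM] at hleft
  have hdet : IsUnit (B9SectDFP.Ginv Kb Δ Q a D Qb ab).det := Matrix.isUnit_det_of_right_inverse hleft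
  have hinv : (B9SectDFP.Ginv Kb Δ Q a D Qb ab)⁻¹ = G0inv⁻¹ * (1 - Tp * G0inv⁻¹)⁻¹ := Matrix.inv_eq_right_inv hleft
  -- FILE 80: the series (3.130) from the left letter (the `𝒞 = 0` instance of (3.138))
  have hpi0 : B9SectDFP.piOp (0 : Matrix X X ℝ) Δ Q a D = 0 := piOp_zero Δ Q a D
  have hrows' : ∀ i, ∑ j, |(G0inv⁻¹ * ((Kb - B9SectDFP.piOp Kb Δ Q a D) + (2 : ℝ) • B9SectDFP.piOp (0 : Matrix X X ℝ) Δ Q a D)) i j| ≤ ρ := by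
    rw [hpi0, smul_zero, add_zero]; exact hrows
  have hser := (B9Thm312Positivity.eq3138_hasSum_posDef_left Kb 0 hKb Matrix.transpose_zero Δ Q a D Qb ab hΔa hρ0 hρ1 hrows').1
  have hG1 : B9Eq3152.G1inv Kb 0 Δ Q a D Qb ab = B9SectDFP.Ginv Kb Δ Q a D Qb ab := by
    rw [B9Eq3152.G1inv, smul_zero, sub_zero]
  rw [hpi0, smul_zero, add_zero, hG1] at hser
  refine ⟨hdet, hinv, ?_, ?_, hser⟩
  · rw [hinv]; exact hpos
  · have h := (hinv ▸ hpos : ((B9SectDFP.Ginv Kb Δ Q a D Qb ab)⁻¹).PosDef).inv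
    rwa [Matrix.nonsing_inv_nonsing_inv _ hdet] at h

end AssembledG

end Literature.MathematicalPhysics.QuantumFieldTheory.Balaban1983to89.B9Eq3130MatrixLetters

end
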